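import Literature.AlgebraicGeometry.HodgeTheory.SecantQuotientJacobianTwistedCarrier
import Literature.AlgebraicGeometry.Motives.JacobianHyperelliptic
import HarnessLib

/-!
# Markman's pinned secant–quotient carrier claim IN ∀-FORM over NON-HYPERELLIPTIC genus-3 data with the pin PRESCRIBED (L1″_∀)
# (drafted by ring2 LEAD gen 160, evidence #15 on stmt-HodgeConjecture-23176; filed by ring2 LEAD gen 161 = typer1 seat gen 159, 2026-08-28, per director-hodge g12
# R12.6 (α) GENERIC-ONLY branch on refute-markman WAKE #8 verdict «GENERIC-ONLY: H_disj», memo `REFUTE-MARKMAN-G11-W8.md` sha256∕16 2304c1596b6083b0 = evidence #16)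

Family `hodge`, layer `Literature/AlgebraicGeometry/HodgeTheory`. Companion of `SecantQuotientJacobianTwistedCarrier.lean` (claim-facts
`Markman2025_secantQuotient_twistedCarrier_onJacobian[_pinned]`, ∃-FORM over print's construction data). Requested by road №4
(`Summits/HodgeConjecture/HodgeConjecture/Theses/VHCAbelianSchemesRoad.lean`, deciding crux stmt-HodgeConjecture-23176; skeleton v3.7 = D1b's stub
2ℓ′ `stub_markmanPinnedForall_TwPrime` and the displayed hypothesis `hMall` of ring2-b03x g8's
`Theorems/VHCAbelianSchemesRoadSecantQuotientOffHyperellipticOfPrintForall.lean` are the H-FREE ∀-form — LEAD 160's draft of this file was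
definitionally that statement (`forall_defeq_check.lean`); WITH print's standing hypothesis H displayed (WAKE #8, below) THIS claim is the WEAKER
statement `H-free form restricted to data satisfying OrbitTranslatesDisjoint`, so road-side users restrict their anchor data to H-good presentations
(skeleton v3.8 on the child crux `DiagLocalOfMarkmanPinnedForall`, route rev 27) instead of consuming `hMall`).

Two declarations: the displayed print hypothesis `OrbitTranslatesDisjoint 𝒥 G₁ G₂` (a definition) and a NAMED CLAIM in hypothesis form (a `def … : Prop`;
users take `(h : … C Adm)`; nothing is asserted):

* `OrbitTranslatesDisjoint 𝒥 G₁ G₂` — print's STANDING hypothesis of §9.1 (p. 57, before Assumption 9.1.1: «Assume that the curves `Cᵢ` are pairwise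
  disjoint and so are the `Σᵢ`»; = «connected components» in §9.3; «n disjoint translates» in §8.2–8.3): the `G₁`-orbit and the `G₂`-orbit of
  translates of the Abel–Jacobi curve `W̃₁(P) = 𝒥.brillNoetherLocus P 1` consist of pairwise disjoint curves, i.e. no non-trivial `g ∈ G₁ ∪ G₂`
  is a difference of two points of the curve; translation-invariant, hence independent of the base point `P`. Print proves it only «for a
  generic `C`» (Lemma 9.1.4: openness in moduli + degeneration) and USES it (Lemma 9.1.2 Step 3, Prop. 9.2.2's component analysis, §8.3).

* `Markman2025_secantQuotient_twistedCarrier_onJacobian_pinnedForall C Adm` — for every EVEN `d ≥ 4`, EVERY smooth projective complex curve `Cᵥ`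
  with a Jacobian `𝒥` of dimension `3` which is NOT HYPERELLIPTIC (`Jacobian.IsHyperelliptic`, `Motives/JacobianHyperelliptic.lean`) and whose
  orbit translates are disjoint (`OrbitTranslatesDisjoint 𝒥 G₁ G₂`, the displayed H of WAKE #8), every
  Riemann theta divisor `Θ` (principal polarisation), all cyclic `G₁, G₂ ≤ J[d+1](ℂ)` of order `d+1` with `G₁ ⊓ G₂ = ⊥` and the translates
  `τ_{g₁+g₂}(Θ)` in general position (`TranslatesInGeneralPosition`, print's Lemma 9.3.1 hypothesis), and EVERY polarisation class `θ₀` of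
  `Θ`: `∃ γ, IsTwistedCarrierWeilPairOn C Adm 𝒥.J … d (secantPolarizationClass … θ₀) γ` — the clause package of the ∃-form claim with its
  leading `∃` over `(Cᵥ, 𝒥, Θ, G₁, G₂)` read as `∀` over the non-hyperelliptic general-position data and the pin `θ₀` PRESCRIBED rather than
  produced (prescribing the pin costs nothing in print: `h ↦ q·h` rescales `c₃` only, §1.3 rank-one invariant line).

WHAT IS AND IS NOT IN PRINT (the WAKE #8 question and its answer, stated so the reader can judge the tag). Print (arXiv:2502.03415 v2,
UNREFEREED) constructs `𝓔̄` on `(J × Ĵ)/Ḡ` for a non-hyperelliptic genus-3 curve (§9, p. 57: «Assume `C` is not hyperelliptic») and proves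
Thm. 1.4.1 item 4 ∕ Thm. 1.5.1 for the constructed object under three displayed assumption blocks: the standing hypothesis «the curves `Cᵢ` are
pairwise disjoint and so are the `Σᵢ`» (here `OrbitTranslatesDisjoint`), Assumption 9.1.1 and Assumption 9.2.1. refute-markman WAKE #8 (hostile
print read, director-hodge g12 R12.5 (3); memo `REFUTE-MARKMAN-G11-W8.md` sha256∕16 2304c1596b6083b0, chunk:line locators of the held e-print)
answered **GENERIC-ONLY: H_disj**: PRINT'S CLAIM HOLDS FOR DATA SATISFYING `OrbitTranslatesDisjoint` — with that hypothesis displayed the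
∀-reading is print-faithful: Assumption 9.2.1 IS the typed `TranslatesInGeneralPosition` (the property used in the proof of Lemma 9.3.1),
Assumption 9.1.1 follows at every such datum from criterion (9.1) of Lemma 9.1.2 and the typed four-fold general position GIVEN H_disj
(Lemma 9.1.2 Step 3 uses it), and no proof step of §9.2–9.3 restricts `C` beyond non-hyperellipticity; H_disj itself is NOT implied by the other
binders (argued in the memo on a 5-torsion-difference family, not proved) and is generic (Lemma 9.1.4). Without H the ∀-form would assert MORE
than print. The conclusion side (`IsTwistedCarrierWeilPairOn`, the admissibility notion, the pin) is the reading of WAKEs #1–#7 of record,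
not re-audited by WAKE #8. The ∃-form file's docstring (gen 86∕152) recorded the ∀-form as «NOT stated» because
non-hyperellipticity was not typable then; it is now (`JacobianHyperelliptic.lean`).

Nothing here is proved or asserted; PREPRINT — UNREFEREED wherever load-bearing; research route conditional on HC_CM; not a corollary;
Q11.4-sentence-2 already refuted in dim ≥ 3; HC_CM HELD, by name only; typed ≠ proved.
-/

noncomputable section

open CategoryTheory

namespace Literature.AlgebraicGeometry.HodgeTheory

open Literature.AlgebraicTopology.SingularHomology
open Literature.AlgebraicGeometry.Motives Literature.AlgebraicGeometry.Markman2025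

/-- **Print's standing hypothesis H_disj «the curves `Cᵢ` are pairwise disjoint and so are the `Σᵢ`» (Markman arXiv:2502.03415 v2 §9.1, p. 57,
before Assumption 9.1.1; «connected components» §9.3; generic by Lemma 9.1.4), displayed by refute-markman WAKE #8 (memo
`REFUTE-MARKMAN-G11-W8.md` 2304c1596b6083b0):** with `Cᵢ = τ_{gᵢ}(C₁)` a `G₁`-orbit and `Σⱼ = τ_{hⱼ}(Σ₁)` a `G₂`-orbit of translates of `∓AJ(C)`,
pairwise disjointness of each orbit is `W̃₁(P) ∩ τ_g(W̃₁(P)) = ∅` for every non-trivial `g ∈ G₁ ∪ G₂` (`W̃₁(P) = 𝒥.brillNoetherLocus P 1`, the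
Abel–Jacobi curve; `G₁ ∨ G₂`, not `G₁ ⊔ G₂` — print never needs mixed sums); translation-invariant, hence independent of `P`. A definition;
nothing asserted. [cite: Markman2025SecantWeil, §9.1 (p. 57) standing assumption and Lemma 9.1.4] -/
def OrbitTranslatesDisjoint {Cᵥ : SchemeOver ℂ} (𝒥 : Jacobian Cᵥ) (G₁ G₂ : Subgroup (𝒥.J.Points ℂ)) : Prop :=
  ∀ (P : AlgPoints Cᵥ ℂ) (g : 𝒥.J.Points ℂ), (g ∈ G₁ ∨ g ∈ G₂) → g ≠ 1 →
    Disjoint (𝒥.brillNoetherLocus P 1) ((𝒥.J.translation g).left.base '' 𝒥.brillNoetherLocus P 1)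

/-- **Markman 2025 (arXiv:2502.03415, UNREFEREED) read in ∀-FORM over non-hyperelliptic genus-3 secant–quotient data in general position,
pin prescribed (L1″_∀):** for every even `d ≥ 4`, every smooth projective complex curve `Cᵥ` with a 3-dimensional NON-HYPERELLIPTIC Jacobian
`𝒥`, every Riemann theta divisor `Θ` which is a principal polarization divisor, all cyclic `G₁, G₂ ≤ J[d+1](ℂ)` of order `d+1` with
`G₁ ⊓ G₂ = ⊥` and translates in general position, and every polarisation class `θ₀` of `Θ`, the secant quotient `(J × Ĵ)/Ḡ` carries an
`Adm`-admissible twisted carrier of Weil shape pinned to `h_Y(θ₀)` (`IsTwistedCarrierWeilPairOn`) — FOR DATA SATISFYING `OrbitTranslatesDisjoint`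
(print's standing hypothesis of §9.1, displayed after the non-hyperellipticity binder: refute-markman WAKE #8 verdict GENERIC-ONLY: H_disj, memo
`REFUTE-MARKMAN-G11-W8.md` 2304c1596b6083b0; director-hodge g12 R12.5 (3) ∕ R12.6 (α)). With H displayed, print's Assumption 9.1.1 and
Assumption 9.2.1 hold at every such datum (Lemma 9.1.2 criterion (9.1); proof of Lemma 9.3.1), so the claim reads print at an ARBITRARY datum
satisfying the binders; PREPRINT, unrefereed. Users take
`(h : Markman2025_secantQuotient_twistedCarrier_onJacobian_pinnedForall C Adm)`. [claim: Markman2025SecantWeil, status: under-review] -/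
def Markman2025_secantQuotient_twistedCarrier_onJacobian_pinnedForall (C : ChernCharacterBetti) (Adm : PerfectAdmissibility) : Prop :=
  ∀ d : ℕ, Even d → 4 ≤ d →
    ∀ (Cᵥ : SchemeOver ℂ) (_ : IsSmoothProjective 1 Cᵥ) (𝒥 : Jacobian Cᵥ) (_ : 𝒥.J.dim = 3)
      (Θ : CartierDivisor 𝒥.J.X.left) (_ : 𝒥.IsRiemannThetaDivisor Θ) (hP : 𝒥.J.IsPrincipalPolarizationDivisor Θ)
      (G₁ G₂ : Subgroup (𝒥.J.Points ℂ)) (h₁ : G₁ ≤ 𝒥.J.torsionPoints ℂ (d + 1 : ℕ))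
      (h₂ : G₂ ≤ 𝒥.J.torsionPoints ℂ (d + 1 : ℕ)),
      ¬ 𝒥.IsHyperelliptic →
      OrbitTranslatesDisjoint 𝒥 G₁ G₂ →
      IsCyclic G₁ → Nat.card G₁ = d + 1 → IsCyclic G₂ → Nat.card G₂ = d + 1 → G₁ ⊓ G₂ = ⊥ →
      TranslatesInGeneralPosition 𝒥.J Θ (sumSet G₁ G₂) →
      ∀ θ₀ : complexBetti 𝒥.J.X 2, 𝒥.J.IsPolarizationClassOf Θ θ₀ →
        ∃ γ, IsTwistedCarrierWeilPairOn C Adm 𝒥.J hP.isAmple hP.KTheta_eq_bot G₁ G₂ (Nat.succ_ne_zero d) h₁ h₂ d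
          (secantPolarizationClass 𝒥.J hP.isAmple G₁ G₂ (Nat.succ_ne_zero d) h₁ h₂ d θ₀) γ

end Literature.AlgebraicGeometry.HodgeTheory

end
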